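import Mathlib.Data.Prod.Lex
import Summits.ValiantsHypothesis.ValiantsHypothesis.Theorems.LiftNullstellensatzLiftWidthPerFourEchelonBasis
import Summits.ValiantsHypothesis.ValiantsHypothesis.Theorems.LiftNullstellensatzLiftWidthPerFourEchelonTransversal
import Summits.ValiantsHypothesis.ValiantsHypothesis.Theorems.LiftNullstellensatzLiftWidthPerFourHallCount
import Summits.ValiantsHypothesis.ValiantsHypothesis.Theorems.LiftNullstellensatzLiftWidthPerFourDefectChartPosition

/-!
# Route LiftNullstellensatz — `LiftWidthPerFour` (item stmt-ValiantsHypothesis-5922): CLAIM F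

**Claim F.** Over a field `K` with `2 ≠ 0` and `|K| = ∞`, a linear space `W` of `4 × 4` matrices
of dimension `≥ 11` on which the permanent vanishes identically is contained in a row space
`{A | A i = 0}` or a column space `{A | Aᵀ j = 0}` (`linearSpace_perm4_row_or_col`).
(Guterman–Meshulam–Spiridonov, arXiv:2212.11193, Thm 1.7 treat dimension `12`; dimension `11` is
the extension needed here.)  Proof: reduced echelon basis w.r.t. the row-major (lexicographic)
order on cells (F1); its leading cells have no transversal (F2); hence (Hall count) they miss a
row or a column; the defect chart (F3, `echelon_family_row_vanishes`, applied directly or to the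
transposes) shows that every basis matrix has that row (column) zero.  Role for the item: the
first/last layer of a homogeneous width-`≤ 5` ABP for `per_4` cuts out such a `W`, which yields
the outer-layer normal form of Cruxes/LiftWidthPerFour/REDUCTION-p1.md.  No new definitions.
-/

namespace Summit.ValiantsHypothesis.LiftNullstellensatz

open Matrix

/-- **Claim F** (linear spaces of codimension `≤ 5` on the permanental hypersurface of `4 × 4`
matrices are row or column spaces). [cite: GutermanMeshulamSpiridonov2023, Thm 1.7 (dim 12; method)] -/
theorem linearSpace_perm4_row_or_col {K : Type*} [Field K] [Infinite K] (h2 : (2 : K) ≠ 0)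
    (W : Submodule K (Matrix (Fin 4) (Fin 4) K)) (hW : 11 ≤ Module.finrank K W)
    (hper : ∀ A ∈ W, A.permanent = 0) :
    (∃ i, ∀ A ∈ W, ∀ j, A i j = 0) ∨ (∃ j, ∀ A ∈ W, ∀ i, A i j = 0) := by
  classical
  -- matrices as functions on cells, cells ordered lexicographically (row-major)
  let eL : Matrix (Fin 4) (Fin 4) K ≃ₗ[K] (Lex (Fin 4 × Fin 4) → K) :=
    { toFun := fun M p => M (ofLex p).1 (ofLex p).2
      invFun := fun v i j => v (toLex (i, j))
      left_inv := fun _ => rfl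
      right_inv := fun _ => rfl
      map_add' := fun _ _ => rfl
      map_smul' := fun _ _ => rfl }
  have heL : ∀ M : Matrix (Fin 4) (Fin 4) K, ∀ i j, eL M (toLex (i, j)) = M i j := fun _ _ _ => rfl
  set V : Submodule K (Lex (Fin 4 × Fin 4) → K) := W.map (eL : _ →ₗ[K] _) with hV
  have hVdim : Module.finrank K V = Module.finrank K W := LinearEquiv.finrank_map_eq eL W
  obtain ⟨S, Av, hAW, hA1, hA0, hAlt, hrep, hcard⟩ := exists_echelon_basis (K := K) V
  -- basis matrices indexed by cells
  let Bm : Fin 4 → Fin 4 → Matrix (Fin 4) (Fin 4) K := fun i j => eL.symm (Av (toLex (i, j)))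
  have hBm : ∀ i j r s, Bm i j r s = Av (toLex (i, j)) (toLex (r, s)) := fun _ _ _ _ => rfl
  have hBmW : ∀ i j, toLex (i, j) ∈ S → Bm i j ∈ W := by
    intro i j hc
    obtain ⟨w, hw, hw'⟩ := Submodule.mem_map.1 (hAW _ hc)
    have : Bm i j = w := by
      show eL.symm (Av (toLex (i, j))) = w
      rw [← hw', LinearEquiv.coe_coe, LinearEquiv.symm_apply_apply]
    rw [this]; exact hw
  -- the set of leading cells as a set of pairs
  set S' : Finset (Fin 4 × Fin 4) := S.map (ofLex : Lex (Fin 4 × Fin 4) ≃ Fin 4 × Fin 4).toEmbedding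
    with hS'
  have hmemS' : ∀ c : Fin 4 × Fin 4, c ∈ S' ↔ toLex c ∈ S := by
    intro c
    simp only [hS', Finset.mem_map_equiv]
    rfl
  have hcardS' : S'.card = Module.finrank K W := by rw [hS', Finset.card_map, hcard, hVdim]
  -- every matrix of W is the combination of the basis matrices with its leading-cell entries
  have hrow_of_basis : ∀ i', (∀ r s, (r, s) ∈ S' → ∀ t, Bm r s i' t = 0) → ∀ A ∈ W, ∀ j, A i' j = 0 := by
    intro i' hB A hA j
    have hv : eL A ∈ V := Submodule.mem_map_of_mem hA
    have := hrep _ hv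
    rw [← heL A i' j, this, Finset.sum_apply]
    refine Finset.sum_eq_zero fun c hc => ?_
    rw [Pi.smul_apply, smul_eq_mul]
    have hc' : ((ofLex c).1, (ofLex c).2) ∈ S' := (hmemS' _).2 (by simpa using hc)
    have := hB _ _ hc' j
    rw [hBm] at this
    have e : toLex ((ofLex c).1, (ofLex c).2) = c := by simp
    rw [e] at this
    rw [this, mul_zero]
  have hcol_of_basis : ∀ j', (∀ r s, (r, s) ∈ S' → ∀ t, Bm r s t j' = 0) → ∀ A ∈ W, ∀ i, A i j' = 0 := by
    intro j' hB A hA i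
    have hv : eL A ∈ V := Submodule.mem_map_of_mem hA
    have := hrep _ hv
    rw [← heL A i j', this, Finset.sum_apply]
    refine Finset.sum_eq_zero fun c hc => ?_
    rw [Pi.smul_apply, smul_eq_mul]
    have hc' : ((ofLex c).1, (ofLex c).2) ∈ S' := (hmemS' _).2 (by simpa using hc)
    have := hB _ _ hc' i
    rw [hBm] at this
    have e : toLex ((ofLex c).1, (ofLex c).2) = c := by simp
    rw [e] at this
    rw [this, mul_zero]
  -- (1) no transversal among the leading cells
  have hnotrans : ¬ ∃ f : Fin 4 → Fin 4, Function.Injective f ∧ ∀ i, (i, f i) ∈ S' := by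
    rintro ⟨f, hf, hfS⟩
    obtain ⟨θ, hθ⟩ := exists_permanent_ne_zero_of_echelon (K := K) (n := 4)
      (fun t => Bm t (f t)) f hf
      (fun t r hrt j => by
        rw [hBm]
        exact hAlt _ ((hmemS' _).1 (hfS t)) _ (Prod.Lex.toLex_lt_toLex.2 (Or.inl hrt)))
      (fun t j hj => by
        rw [hBm]
        exact hAlt _ ((hmemS' _).1 (hfS t)) _ (Prod.Lex.toLex_lt_toLex.2 (Or.inr ⟨rfl, hj⟩)))
      (fun t => by rw [hBm]; exact hA1 _ ((hmemS' _).1 (hfS t)))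
    exact hθ (hper _ (W.sum_mem fun t _ => W.smul_mem _ (hBmW _ _ ((hmemS' _).1 (hfS t)))))
  -- (2) hence a row or a column carries no leading cell
  have hrowcol : (∃ i, ∀ j, (i, j) ∉ S') ∨ (∃ j, ∀ i, (i, j) ∉ S') := by
    by_contra hcon
    push Not at hcon
    obtain ⟨hr, hc⟩ := hcon
    apply hnotrans
    refine exists_transversal_of_compl_card_le (le_refl 4) S' hr hc ?_
    rw [Finset.card_compl, hcardS', Fintype.card_prod, Fintype.card_fin]
    omega
  -- (3) the defect lemma, rows: if row `i'` carries no leading cell then all basis matrices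
  -- have zero row `i'`
  have hdefect : ∀ (T : Finset (Fin 4 × Fin 4)) (i' : Fin 4), 11 ≤ T.card → (∀ j, (i', j) ∉ T) →
      ∀ c₀ ∈ T, ∃ ab : Fin 4 × Fin 4, ab.1 ≠ i' ∧ ab ≠ c₀ ∧ ∀ c : Fin 4 × Fin 4, c.1 ≠ i' → c ≠ ab → c ∈ T := by
    intro T i' hT hi' c₀ hc₀
    let R : Finset (Fin 4 × Fin 4) := Finset.univ.filter fun c => c.1 ≠ i'
    have hTR : T ⊆ R := by
      intro c hc
      simp only [R, Finset.mem_filter, Finset.mem_univ, true_and]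
      rintro rfl; exact hi' _ (by simpa using hc)
    have hRcard : R.card = 12 := by
      have : R = (Finset.univ.erase i') ×ˢ (Finset.univ : Finset (Fin 4)) := by
        ext c; simp [R, Finset.mem_product, and_comm]
      rw [this, Finset.card_product, Finset.card_erase_of_mem (Finset.mem_univ _),
        Finset.card_univ, Fintype.card_fin]
    have hdiff : (R \ T).card ≤ 1 := by
      rw [Finset.card_sdiff_of_subset hTR]
      omega
    by_cases hne : (R \ T).Nonempty
    · obtain ⟨d, hd⟩ := hne
      refine ⟨d, ?_, ?_, ?_⟩
      · exact (Finset.mem_filter.1 (Finset.mem_sdiff.1 hd).1).2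
      · rintro rfl; exact (Finset.mem_sdiff.1 hd).2 hc₀
      · intro c hc hcd
        by_contra hcT
        have hc' : c ∈ R \ T := Finset.mem_sdiff.2 ⟨by simp [R, hc], hcT⟩
        have : 2 ≤ (R \ T).card := by
          rw [← Finset.card_pair hcd]
          exact Finset.card_le_card (by
            intro x hx
            rcases Finset.mem_insert.1 hx with rfl | hx
            · exact hc'
            · rw [Finset.mem_singleton.1 hx]; exact hd)
        omega
    · rw [Finset.not_nonempty_iff_eq_empty, Finset.sdiff_eq_empty_iff_subset] at hne
      refine ⟨(c₀.1, if c₀.2 = 0 then 1 else 0), ?_, ?_, ?_⟩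
      · exact (Finset.mem_filter.1 (hTR hc₀)).2
      · intro h
        have := (Prod.ext_iff.1 h).2
        simp only at this
        split_ifs at this with h0
        · rw [h0] at this; exact absurd this (by decide)
        · exact h0 this.symm
      · intro c hc _
        exact hne (by simp [R, hc])
  rcases hrowcol with ⟨i', hi'⟩ | ⟨j', hj'⟩
  · -- row case
    left
    refine ⟨i', hrow_of_basis i' ?_⟩
    intro r s hrs t
    have hT : 11 ≤ S'.card := by rw [hcardS']; exact hW
    obtain ⟨⟨a, b⟩, hai, hab, hfull⟩ := hdefect S' i' hT hi' (r, s) hrs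
    have hr : r ≠ i' := by rintro rfl; exact hi' _ hrs
    refine echelon_family_row_vanishes h2 W hper i' a b hai Bm
      (fun r s hr hrs => hBmW _ _ ((hmemS' _).1 (hfull (r, s) hr hrs)))
      (fun r s hr hrs => by rw [hBm]; exact hA1 _ ((hmemS' _).1 (hfull (r, s) hr hrs)))
      (fun r s hr hrs r' s' hr' hrs' hne => by
        rw [hBm]
        refine hA0 _ ((hmemS' _).1 (hfull (r, s) hr hrs)) _ ((hmemS' _).1 (hfull (r', s') hr' hrs')) ?_
        intro h; exact hne (toLex.injective h |>.symm ▸ rfl))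
      r s hr (fun h => hab h.symm) t
  · -- column case: transpose
    right
    refine ⟨j', hcol_of_basis j' ?_⟩
    intro r s hrs t
    have hT : 11 ≤ (S'.map (Equiv.prodComm (Fin 4) (Fin 4)).toEmbedding).card := by
      rw [Finset.card_map, hcardS']; exact hW
    have hj'T : ∀ j, (j', j) ∉ S'.map (Equiv.prodComm (Fin 4) (Fin 4)).toEmbedding := by
      intro j h
      rw [Finset.mem_map_equiv] at h
      exact hj' j (by simpa using h)
    have hsrT : (s, r) ∈ S'.map (Equiv.prodComm (Fin 4) (Fin 4)).toEmbedding := by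
      rw [Finset.mem_map_equiv]; simpa using hrs
    obtain ⟨⟨a, b⟩, haj, hab, hfull⟩ := hdefect _ j' hT hj'T (s, r) hsrT
    have hfull' : ∀ c : Fin 4 × Fin 4, c.1 ≠ j' → c ≠ (a, b) → (c.2, c.1) ∈ S' := by
      intro c hc hcab
      have := hfull c hc hcab
      rw [Finset.mem_map_equiv, Equiv.prodComm_symm, Equiv.prodComm_apply] at this
      exact this
    have hs : s ≠ j' := by rintro rfl; exact hj' _ hrs
    -- the transposed family in the transposed space
    let Wt : Submodule K (Matrix (Fin 4) (Fin 4) K) :=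
      W.map (Matrix.transposeLinearEquiv (Fin 4) (Fin 4) K K : _ →ₗ[K] _)
    have hperT : ∀ A ∈ Wt, A.permanent = 0 := by
      intro A hA
      obtain ⟨M, hM, rfl⟩ := Submodule.mem_map.1 hA
      show (Mᵀ).permanent = 0
      rw [Matrix.permanent_transpose]; exact hper M hM
    have key := echelon_family_row_vanishes h2 Wt hperT j' a b haj (fun p q => (Bm q p)ᵀ)
      (fun p q hp hpq => Submodule.mem_map_of_mem (hBmW _ _ ((hmemS' _).1 (hfull' (p, q) hp hpq))))
      (fun p q hp hpq => by
        rw [Matrix.transpose_apply, hBm]; exact hA1 _ ((hmemS' _).1 (hfull' (p, q) hp hpq)))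
      (fun p q hp hpq p' q' hp' hpq' hne => by
        rw [Matrix.transpose_apply, hBm]
        refine hA0 _ ((hmemS' _).1 (hfull' (p, q) hp hpq)) _ ((hmemS' _).1 (hfull' (p', q') hp' hpq')) ?_
        intro h
        have := Prod.mk.inj (toLex.injective h)
        exact hne (by rw [this.1, this.2]))
      s r hs (fun h => hab h.symm) t
    rw [Matrix.transpose_apply] at key
    exact key

end Summit.ValiantsHypothesis.LiftNullstellensatz
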